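import Literature.Probability.RandomPlanarGeometry.RectangleModulusProofs
import Literature.Probability.RandomPlanarGeometry.EllipticKBasic
import HarnessLib

/-!
# The conformal modulus of a rectangle as a function of the aspect ratio — proof of
# `rectangle_crossRatio_eq_of_aspectRatio` (Bollobás–Riordan 2006, Ch. 7 §7.1, p. 184)

This file discharges the named fact
`Literature.Probability.RandomPlanarGeometry.rectangle_crossRatio_eq_of_aspectRatio`
(`RectangleModulus.lean`): there is ONE function `η : (0,∞) → (0,1)`, strictly decreasing and onto,
such that every axis-parallel rectangle `(0,w) × (0,h)` with corners marked `ih, 0, w, w + ih` has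
Cardy cross-ratio `η(w/h)` for every uniformizing datum.

Proof (exactly the parenthesis of Bollobás–Riordan p. 185, "In particular, this shows that
`η(r) = η(D₄(r))` is monotone decreasing in `r`"): by the explicit elliptic parametrisation
`rectangle_crossRatio_eq_elliptic_holds` (tree, `RectangleModulusProofs.lean`: aspect ratio
`2K(k²)/K(1−k²)` ↦ cross-ratio `(1−k)²/(1+k)²`) it suffices to invert `k ↦ K(1−k²)/K(k²)` on
`(0,1)`. That quotient is strictly decreasing (the tree's `ellipticK_strictMonoOn`) and takes every
positive value exactly once (the tree's `exists_ellipticK_compl_eq_mul` /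
`existsUnique_ellipticK_compl_eq_mul`, `EllipticKBasic.lean`); so `r ↦ k(r)`, the modulus with
`K′(k)/K(k) = 2/r`, is strictly increasing on `(0,∞)`, and `η(r) = ((1−k(r))/(1+k(r)))²` is strictly
decreasing with values in `(0,1)`, every `v ∈ (0,1)` being attained at the aspect ratio of the
modulus `k = (1−√v)/(1+√v)`. No theta functions are needed (for the identification `η(r) = λ(2i/r)`
with the elliptic modular function see `Literature/Analysis/SpecialFunctions/JacobiThetaAGM.lean`,
`ellipticK_one_sub_lamR`).

## References

* B. Bollobás, O. Riordan, *Percolation*, CUP (2006), Ch. 7 §7.1, pp. 184–185.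
  [BollobasRiordan2006]
-/

noncomputable section

open Set

namespace Literature.Probability.RandomPlanarGeometry

/-- **`k ↦ K′(k)/K(k) = K(1−k²)/K(k²)` is strictly decreasing on `(0,1)`** (numerator strictly
decreasing, denominator strictly increasing, both positive). [folklore] -/
theorem ellipticK_ratio_strictAntiOn :
    StrictAntiOn (fun k : ℝ => ellipticK (1 - k ^ 2) / ellipticK (k ^ 2)) (Ioo 0 1) := by
  intro k₁ h₁ k₂ h₂ hlt
  have hsq : k₁ ^ 2 < k₂ ^ 2 := by nlinarith [h₁.1, h₂.1]
  have hk₁1 : k₁ ^ 2 < 1 := by nlinarith [h₁.1, h₁.2]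
  have hk₂1 : k₂ ^ 2 < 1 := by nlinarith [h₂.1, h₂.2]
  have hK : ellipticK (k₁ ^ 2) < ellipticK (k₂ ^ 2) :=
    ellipticK_strictMonoOn (show k₁ ^ 2 ∈ Iio (1:ℝ) from hk₁1) (show k₂ ^ 2 ∈ Iio (1:ℝ) from hk₂1)
      hsq
  have hK' : ellipticK (1 - k₂ ^ 2) < ellipticK (1 - k₁ ^ 2) :=
    ellipticK_strictMonoOn (show 1 - k₂ ^ 2 ∈ Iio (1:ℝ) by simp; exact pow_pos h₂.1 2)
      (show 1 - k₁ ^ 2 ∈ Iio (1:ℝ) by simp; exact pow_pos h₁.1 2) (by linarith)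
  have hp₁ : 0 < ellipticK (k₁ ^ 2) := ellipticK_pos (sq_nonneg _) hk₁1
  have hp₂ : 0 < ellipticK (k₂ ^ 2) := ellipticK_pos (sq_nonneg _) hk₂1
  have hq₂ : 0 < ellipticK (1 - k₂ ^ 2) := ellipticK_pos (by nlinarith) (by nlinarith [h₂.1])
  show ellipticK (1 - k₂ ^ 2) / ellipticK (k₂ ^ 2) < ellipticK (1 - k₁ ^ 2) / ellipticK (k₁ ^ 2)
  calc ellipticK (1 - k₂ ^ 2) / ellipticK (k₂ ^ 2)
      < ellipticK (1 - k₁ ^ 2) / ellipticK (k₂ ^ 2) := div_lt_div_of_pos_right hK' hp₂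
    _ ≤ ellipticK (1 - k₁ ^ 2) / ellipticK (k₁ ^ 2) :=
        div_le_div_of_nonneg_left (hq₂.le.trans hK'.le) hp₁ hK.le

/-- `k ↦ ((1−k)/(1+k))²` is strictly decreasing on `(0,1)` with values in `(0,1)`. [folklore] -/
theorem crossRatio_modulus_strictAntiOn :
    StrictAntiOn (fun k : ℝ => (1 - k) ^ 2 / (1 + k) ^ 2) (Ioo 0 1) := by
  intro k₁ h₁ k₂ h₂ hlt
  show (1 - k₂) ^ 2 / (1 + k₂) ^ 2 < (1 - k₁) ^ 2 / (1 + k₁) ^ 2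
  rw [div_lt_div_iff₀ (by nlinarith [h₂.1]) (by nlinarith [h₁.1])]
  have h1 : 0 < (1 - k₁) * (1 + k₂) - (1 - k₂) * (1 + k₁) := by nlinarith
  have h2 : 0 < (1 - k₁) * (1 + k₂) + (1 - k₂) * (1 + k₁) := by nlinarith [h₁.2, h₂.2, h₁.1, h₂.1]
  nlinarith [mul_pos h1 h2]

/-- `((1−k)/(1+k))² ∈ (0,1)` for `0 < k < 1`. [folklore] -/
theorem crossRatio_modulus_mem_Ioo {k : ℝ} (hk : k ∈ Ioo (0:ℝ) 1) :
    (1 - k) ^ 2 / (1 + k) ^ 2 ∈ Ioo (0:ℝ) 1 := by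
  have h1 : 0 < 1 + k := by linarith [hk.1]
  refine ⟨div_pos (pow_pos (by linarith [hk.2]) 2) (pow_pos h1 2), ?_⟩
  rw [div_lt_one (pow_pos h1 2)]
  nlinarith [hk.1, hk.2]

/-- **Bollobás–Riordan, Ch. 7 §7.1 p. 184, PROVED**: the conformal modulus (Cardy cross-ratio) of
the corner-marked rectangle `(0,w)×(0,h)` is a strictly decreasing function `η(w/h)` of the aspect
ratio, mapping `(0,∞)` onto `(0,1)`. Here `η(r) = ((1−k)/(1+k))²` with `k = k(r)` the unique
modulus `0 < k < 1` such that `K(1−k²) = (2/r)·K(k²)` (so that `2K(k²)/K(1−k²) = r`), and the value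
for rectangles is the tree's `rectangle_crossRatio_eq_elliptic_holds`.
[cite: BollobasRiordan2006, Ch. 7 §7.1 p. 184] -/
theorem rectangle_crossRatio_eq_of_aspectRatio_holds : rectangle_crossRatio_eq_of_aspectRatio := by
  classical
  -- `kOf c`: the modulus with `K(1−k²) = c·K(k²)` (`c > 0`; junk value `1/2` otherwise)
  let kOf : ℝ → ℝ := fun c =>
    if hc : 0 < c then Classical.choose (exists_ellipticK_compl_eq_mul hc) else 1 / 2
  have kOf_spec : ∀ {c : ℝ}, 0 < c →
      0 < kOf c ∧ kOf c < 1 ∧ ellipticK (1 - kOf c ^ 2) = c * ellipticK (kOf c ^ 2) := by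
    intro c hc
    simp only [kOf, dif_pos hc]
    exact Classical.choose_spec (exists_ellipticK_compl_eq_mul hc)
  have kOf_unique : ∀ {c k : ℝ}, 0 < c → 0 < k → k < 1 →
      ellipticK (1 - k ^ 2) = c * ellipticK (k ^ 2) → k = kOf c := by
    intro c k hc hk0 hk1 hk
    obtain ⟨k₀, -, huniq⟩ := existsUnique_ellipticK_compl_eq_mul hc
    obtain ⟨h0, h1, h⟩ := kOf_spec hc
    rw [huniq k ⟨hk0, hk1, hk⟩, huniq (kOf c) ⟨h0, h1, h⟩]
  -- the ratio `K′/K` at `kOf c` is `c`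
  have ratio_kOf : ∀ {c : ℝ}, 0 < c →
      ellipticK (1 - kOf c ^ 2) / ellipticK (kOf c ^ 2) = c := by
    intro c hc
    obtain ⟨h0, h1, h⟩ := kOf_spec hc
    have hp : 0 < ellipticK (kOf c ^ 2) := ellipticK_pos (sq_nonneg _) (by nlinarith)
    rw [div_eq_iff hp.ne', h]
  -- `c ↦ kOf c` is strictly decreasing on `(0,∞)`
  have kOf_lt : ∀ {c₁ c₂ : ℝ}, 0 < c₂ → c₂ < c₁ → kOf c₁ < kOf c₂ := by
    intro c₁ c₂ hc₂ hlt
    have hc₁ : 0 < c₁ := hc₂.trans hlt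
    obtain ⟨h0₁, h1₁, -⟩ := kOf_spec hc₁
    obtain ⟨h0₂, h1₂, -⟩ := kOf_spec hc₂
    by_contra hle
    rcases (not_lt.mp hle).lt_or_eq with hlt' | heq
    · have h := ellipticK_ratio_strictAntiOn ⟨h0₂, h1₂⟩ ⟨h0₁, h1₁⟩ hlt'
      simp only at h
      rw [ratio_kOf hc₁, ratio_kOf hc₂] at h
      linarith
    · have h₁ := ratio_kOf hc₁
      have h₂ := ratio_kOf hc₂
      rw [heq] at h₂
      linarith [h₁.symm.trans h₂]
  -- the modulus function of the aspect ratio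
  let η : ℝ → ℝ := fun r => (1 - kOf (2 / r)) ^ 2 / (1 + kOf (2 / r)) ^ 2
  refine ⟨η, ?_, ?_, ?_⟩
  · -- strictly decreasing
    intro r₁ hr₁ r₂ hr₂ hlt
    have hr₁' : (0:ℝ) < r₁ := hr₁
    have hr₂' : (0:ℝ) < r₂ := hr₂
    have hc : 2 / r₂ < 2 / r₁ := div_lt_div_of_pos_left two_pos hr₁' hlt
    have hk : kOf (2 / r₁) < kOf (2 / r₂) := kOf_lt (div_pos two_pos hr₂') hc
    obtain ⟨h0₁, h1₁, -⟩ := kOf_spec (div_pos two_pos hr₁')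
    obtain ⟨h0₂, h1₂, -⟩ := kOf_spec (div_pos two_pos hr₂')
    exact crossRatio_modulus_strictAntiOn ⟨h0₁, h1₁⟩ ⟨h0₂, h1₂⟩ hk
  · -- onto `(0,1)`
    apply Subset.antisymm
    · rintro _ ⟨r, hr, rfl⟩
      obtain ⟨h0, h1, -⟩ := kOf_spec (div_pos two_pos (show (0:ℝ) < r from hr))
      exact crossRatio_modulus_mem_Ioo ⟨h0, h1⟩
    · intro v hv
      set s := Real.sqrt v with hs
      have hs0 : 0 < s := Real.sqrt_pos.mpr hv.1
      have hs1 : s < 1 := by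
        rw [hs, show (1:ℝ) = Real.sqrt 1 by simp]
        exact Real.sqrt_lt_sqrt hv.1.le hv.2
      set k := (1 - s) / (1 + s) with hkdef
      have hk0 : 0 < k := div_pos (by linarith) (by linarith)
      have hk1 : k < 1 := by rw [hkdef, div_lt_one (by linarith)]; linarith
      have hKp : 0 < ellipticK (k ^ 2) := ellipticK_pos (sq_nonneg _) (by nlinarith)
      have hK'p : 0 < ellipticK (1 - k ^ 2) := ellipticK_pos (by nlinarith) (by nlinarith)
      set c := ellipticK (1 - k ^ 2) / ellipticK (k ^ 2) with hcdef
      have hc : 0 < c := div_pos hK'p hKp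
      have hkc : k = kOf c := kOf_unique hc hk0 hk1 (by rw [hcdef, div_mul_cancel₀ _ hKp.ne'])
      refine ⟨2 / c, div_pos two_pos hc, ?_⟩
      show (1 - kOf (2 / (2 / c))) ^ 2 / (1 + kOf (2 / (2 / c))) ^ 2 = v
      rw [div_div_cancel₀ two_ne_zero, ← hkc]
      have e : (1 - k) / (1 + k) = s := by
        rw [hkdef]
        field_simp
        ring
      rw [← div_pow, e, hs, Real.sq_sqrt hv.1.le]
  · -- the value for rectangles
    intro R w h hw hh hcar hpt φ x hφx
    have hr : 0 < w / h := div_pos hw hh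
    obtain ⟨h0, h1, hspec⟩ := kOf_spec (div_pos two_pos hr)
    have hKp : 0 < ellipticK (kOf (2 / (w / h)) ^ 2) := ellipticK_pos (sq_nonneg _) (by nlinarith)
    have key : ∀ {K c : ℝ}, 0 < K → 0 < c → 2 * K / (c * K) = 2 / c := by
      intro K c hK hc
      field_simp
    have hratio : w / h = 2 * ellipticK (kOf (2 / (w / h)) ^ 2) /
        ellipticK (1 - kOf (2 / (w / h)) ^ 2) := by
      rw [hspec, key hKp (div_pos two_pos hr), div_div_cancel₀ two_ne_zero]
    exact rectangle_crossRatio_eq_elliptic_holds _ h0 h1 R w h hw hh hratio hcar hpt φ x hφx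

end Literature.Probability.RandomPlanarGeometry
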